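import Literature.NumberTheory.DiophantineGeometry.PastenValuationProductsProofs
import Literature.NumberTheory.EllipticCurves.PastenValuationProductSemistableProofs
import Literature.NumberTheory.DiophantineGeometry.AbcValuationProduct
import HarnessLib

/-!
# Pasten's Corollary 16.2 from his Theorem 16.1: the printed glue

H. Pasten, *Shimura curves and the abc conjecture*, J. Number Theory 254 (2024) 214–335
(= arXiv:1705.09251, held; read p. 49 of the arXiv text: Theorem 16.1, Corollary 16.2 and their
proofs; p. 12: "admissible factorisation").

This file accompanies `PastenValuationProducts.lean` (named fact `pasten_valuationProduct_awayFrom`,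
Pasten's Corollary 16.2) and `PastenValuationProductsProofs.lean` (the dedup `Iff`s with the other
vendorings). It proves **the printed proof of Corollary 16.2**
(`pasten_valuationProduct_awayFrom_of_thm16_1`): Pasten derives Cor. 16.2 from his Theorem 16.1 —
"for all but finitely many `E/ℚ` semi-stable away from `S` and every admissible factorisation
`N_E = DM` (i.e. `D` the product of an EVEN number of distinct primes, `(D, M) = 1`; equivalently
`D` a set of an even number of primes `p ∥ N_E`, the primes of multiplicative reduction),
`∏_{p ∣ D} v_p(Δ_E) < N_E^{11/3+ε}`" — by taking `D = N_E^*` when the number `n` of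
multiplicative primes is even, and otherwise (`n ≥ 3` odd) the `n` leave-one-out sets
`D = N_E^*/p_i`, using `∏_{p ∣ N_E^*} v_p(Δ_E) = (∏_i ∏_{p ∣ N_E^*/p_i} v_p(Δ_E))^{1/(n-1)}` and
`11/3 · n/(n-1) ≤ 11/2`. We formalise exactly this glue (leave-one-out product identity
`prod_prod_erase_eq_pow`, the `(n-1)`-th root step `lt_rpow_three_halves_of_pow_pred_lt`, the
combinatorial core `cast_prod_lt_rpow_of_forall_even`), with Theorem 16.1 — in the same constant
form `∃ K_{S,ε}` as the facts of `PastenValuationProducts.lean` — as an explicit INLINE hypothesis.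
Theorem 16.1 itself rests on Shimura-curve parametrisations `X_0^D(M) → E` (Jacquet–Langlands,
modularity of `E/ℚ`), the refined Ribet–Takahashi formula (§6), Frey's degree formula and Faltings
heights, the Arakelov lower bound Thm. 14.1 for integral quaternionic forms, Murty's Petersson-norm
bound, the Manin-constant corollary and the Mazur–Kenku isogeny bound, none of which the tree
has; it is NOT vendored as a named fact here (D-0026), only quoted as a hypothesis, so this file
adds no definition.

Theorem 16.1 is printed "for all but finitely many `E/ℚ` semi-stable away from `S`", and its
printed proof delivers it as a CONDUCTOR THRESHOLD ("provided that `N ≫_ε 1` … for `N ≫_{ε,S} 1` we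
obtain (16.7)", p. 49; p. 12: "We will be willing to discard finitely many (isomorphism classes of)
elliptic curves in several of our arguments, which is the same as letting `N` be large enough, by
Shafarevich's theorem"). `pasten_valuationProduct_awayFrom_of_thm16_1_threshold` takes Theorem 16.1
in exactly that threshold form (`∃ N₀(S, ε)`, bound `N^{11/3+ε}` with no constant) and absorbs the
curves of conductor `< N₀` into the constant through Shafarevich's theorem, which the tree PROVES
(`WeierstrassCurve.shafarevich_finite_goodReductionOutside_holds`, used through
`Literature.NumberTheory.EllipticCurves.exists_multiplicativeValuationProduct_le_of_conductorNorm_lt`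
of `EllipticCurves/PastenValuationProductSemistableProofs.lean`); the same hypothesis yields the
two other vendorings of Cor. 16.2 (`pastenShimura2024_cor_16_2_of_thm16_1_threshold`,
`pasten_cor_16_2_of_thm16_1_threshold`).

Finally, the printed proof of Theorem 16.1 itself (p. 49, (EqUsingRT)–(16.7)) is an assembly of
eight deep inputs by real arithmetic; `pasten_thm16_1_threshold_of_printedInputs` performs that
assembly with the eight inputs as ONE explicit hypothesis (the refined Ribet–Takahashi inequality
Thm. 6.1 (a), Frey's formula for `X_0(N) → A_{1,N}` and its quaternionic analogue for
`X_0^D(M) → A_{D,M}`, Cor. CoroDegApproxQ, the Mazur–Kenku/Faltings height comparison, Murty's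
`‖f‖² ≪ N log N`, Thm. 14.1, Cor. CoroManinCt — quoted as relations between real numbers attached
to `(E, D)`, since the tree has no Shimura curves), including the "`N ≫_{ε,S} 1`" absorption of
the lower-order terms (`ω(D) ≤ ω(N) = o(log N)`, `log log N = o(log N)`), and
`pasten_valuationProduct_awayFrom_of_printedInputs` chains it with the threshold glue. So the
whole of p. 49 is formalised; what remains for `pasten_valuationProduct_awayFrom_holds` is exactly
the eight inputs.

What is NOT here: the eight inputs, i.e. a proof of Theorem 16.1 / Corollary 16.2 themselves.
-/

noncomputable section

open IsDedekindDomain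

namespace Literature.NumberTheory.DiophantineGeometry

/-! ### Corollary 16.2 from Theorem 16.1 (Pasten's printed proof, p. 49 of arXiv:1705.09251) -/

section Glue

variable {ι : Type*}

/-- Leave-one-out products: `(∏_T f) · ∏_{q ∈ T} ∏_{T ∖ {q}} f = (∏_T f)^{#T}`, since
`f q · ∏_{T ∖ {q}} f = ∏_T f` for each `q ∈ T`. [folklore] -/
theorem prod_mul_prod_prod_erase [DecidableEq ι] (T : Finset ι) (f : ι → ℕ) :
    (∏ p ∈ T, f p) * ∏ q ∈ T, ∏ p ∈ T.erase q, f p = (∏ p ∈ T, f p) ^ T.card := by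
  rw [← Finset.prod_const, ← Finset.prod_mul_distrib]
  exact Finset.prod_congr rfl fun q hq ↦ Finset.mul_prod_erase T f hq

/-- Leave-one-out products: if `∏_T f ≠ 0` then `∏_{q ∈ T} ∏_{T ∖ {q}} f = (∏_T f)^{#T - 1}` —
Pasten's identity `∏_{p ∣ N^*} v_p = (∏_i ∏_{p ∣ N^*/p_i} v_p)^{1/(n-1)}` (proof of Cor. 16.2).
[cite: PastenShimura2024, §16.1 proof of Corollary CoroValGen (arXiv Cor. 16.2)] -/
theorem prod_prod_erase_eq_pow [DecidableEq ι] (T : Finset ι) (f : ι → ℕ) (hT : T.Nonempty)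
    (h0 : ∏ p ∈ T, f p ≠ 0) :
    ∏ q ∈ T, ∏ p ∈ T.erase q, f p = (∏ p ∈ T, f p) ^ (T.card - 1) := by
  apply Nat.eq_of_mul_eq_mul_left (Nat.pos_of_ne_zero h0)
  rw [prod_mul_prod_prod_erase, ← pow_succ', Nat.sub_add_cancel hT.card_pos]

/-- The `(n-1)`-th root step of the proof of Cor. 16.2: if `P^{n-1} < B^n` with `B ≥ 1` and
`n ≥ 3`, then `P < B^{n/(n-1)} ≤ B^{3/2}` (Pasten: "`11/3 · n/(n-1) ≤ 11/2`"). [folklore] -/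
theorem lt_rpow_three_halves_of_pow_pred_lt {P B : ℝ} {n : ℕ} (hB : 1 ≤ B) (hn : 3 ≤ n)
    (h : P ^ (n - 1) < B ^ n) : P < B ^ ((3 : ℝ) / 2) := by
  have hB0 : 0 ≤ B := zero_le_one.trans hB
  have hn3 : (3 : ℝ) ≤ n := by exact_mod_cast hn
  have hn1 : ((n - 1 : ℕ) : ℝ) = (n : ℝ) - 1 := by
    rw [Nat.cast_sub (by omega : 1 ≤ n), Nat.cast_one]
  set C : ℝ := B ^ ((n : ℝ) / ((n : ℝ) - 1)) with hC
  have hC0 : 0 ≤ C := Real.rpow_nonneg hB0 _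
  have hCpow : C ^ (n - 1) = B ^ n := by
    rw [hC, ← Real.rpow_natCast, ← Real.rpow_mul hB0, hn1, div_mul_cancel₀ _ (by linarith),
      Real.rpow_natCast]
  have hPC : P < C := lt_of_pow_lt_pow_left₀ (n - 1) hC0 (by rwa [hCpow])
  refine hPC.trans_le (Real.rpow_le_rpow_of_exponent_le hB ?_)
  rw [div_le_iff₀ (by linarith)]
  linarith

/-- The combinatorial core of Pasten's proof of Cor. 16.2: if every even-cardinality `D ⊆ T` has
`∏_D f < B` (`B ≥ 1`) and `#T ≥ 2`, then `∏_T f < B^{3/2}` — for `#T` even take `D = T`; for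
`#T = n ≥ 3` odd multiply the `n` leave-one-out bounds, `(∏_T f)^{n-1} < B^n`.
[cite: PastenShimura2024, §16.1 proof of Corollary CoroValGen (arXiv Cor. 16.2)] -/
theorem cast_prod_lt_rpow_of_forall_even {T : Finset ℕ} {f : ℕ → ℕ} {B : ℝ} (hB : 1 ≤ B)
    (hT : 2 ≤ T.card) (hD : ∀ D ⊆ T, Even D.card → ((∏ p ∈ D, f p : ℕ) : ℝ) < B) :
    ((∏ p ∈ T, f p : ℕ) : ℝ) < B ^ ((3 : ℝ) / 2) := by
  have hBle : B ≤ B ^ ((3 : ℝ) / 2) := by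
    calc B = B ^ (1 : ℝ) := (Real.rpow_one B).symm
      _ ≤ B ^ ((3 : ℝ) / 2) := Real.rpow_le_rpow_of_exponent_le hB (by norm_num)
  rcases Nat.even_or_odd T.card with heven | hodd
  · exact (hD T Finset.Subset.rfl heven).trans_le hBle
  · have hn3 : 3 ≤ T.card := by
      rcases hodd with ⟨m, hm⟩
      omega
    by_cases hP0 : ∏ p ∈ T, f p = 0
    · rw [hP0, Nat.cast_zero]
      exact Real.rpow_pos_of_pos (by linarith) _
    · have hTne : T.Nonempty := Finset.card_pos.mp (by omega)
      have hlt : ((∏ q ∈ T, ∏ p ∈ T.erase q, f p : ℕ) : ℝ) < B ^ T.card := by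
        rw [Nat.cast_prod, ← Finset.prod_const]
        refine Finset.prod_lt_prod_of_nonempty ?_ ?_ hTne
        · intro q hq
          have hq0 : ∏ p ∈ T.erase q, f p ≠ 0 := fun hq0 ↦ hP0 (by
            rw [← Finset.mul_prod_erase T f hq, hq0, mul_zero])
          exact Nat.cast_pos.mpr (Nat.pos_of_ne_zero hq0)
        · intro q hq
          refine hD (T.erase q) (T.erase_subset q) ?_
          rw [Finset.card_erase_of_mem hq]
          exact Nat.Odd.sub_odd hodd odd_one
      rw [prod_prod_erase_eq_pow T f hTne hP0, Nat.cast_pow] at hlt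
      exact lt_rpow_three_halves_of_pow_pred_lt hB hn3 hlt

end Glue

/-- **Pasten's proof of Corollary 16.2 from Theorem 16.1** (arXiv:1705.09251, §16.1, p. 49:
"When `E` has an even number of primes of multiplicative reduction the result follows from
Theorem 16.1 with `D = N_E^*`. When `E` has an odd number `n` of primes of multiplicative
reduction, necessarily `n ≥ 3` by our assumptions. Call these primes `p_1, …, p_n`, then
`∏_{p ∣ N_E^*} v_p(Δ_E) = (∏_{i=1}^n ∏_{p ∣ (N_E^*/p_i)} v_p(Δ_E))^{1/(n-1)}`. The result follows
from Theorem 16.1 for the various `D = N_E^*/p_i`, since `11/3 · n/(n-1) ≤ 11/2`.").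
The hypothesis `h16` is Theorem 16.1 ("Let `S` be a finite set of primes and let `ε > 0`. For all
but finitely many elliptic curves `E/ℚ` semi-stable away from `S`, the following holds: … Consider
an admissible factorization `N = DM` … Then `∏_{p ∣ D} v_p(Δ_E) < N^{11/3+ε}`"), rendered over the
vocabulary of `pasten_valuationProduct_awayFrom`: an admissible `D` (product of an even number of
distinct primes with `(D, N/D) = 1`, p. 12) is a finite set `D` of even cardinality of primes
`p ∥ N_E` (conductor exponent `1`, i.e. multiplicative reduction), and "all but finitely many `E`"
is absorbed into a constant `K = K_{S,ε}` exactly as in the facts of `PastenValuationProducts.lean`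
(the finitely many exceptional curves have finitely many admissible `D`). Theorem 16.1 is the deep
input (Shimura-curve parametrisations, Jacquet–Langlands and modularity, refined Ribet–Takahashi,
Arakelov bounds) and is only quoted here as a hypothesis, not vendored. With `ε' = 2ε/3` in `h16`
the constant obtained is `max(K_{S,ε'}, 1)²`.
[cite: PastenShimura2024, §16.1 Corollary CoroValGen (arXiv Cor. 16.2), proof] -/
theorem pasten_valuationProduct_awayFrom_of_thm16_1
    (h16 : ∀ (S : Finset ℕ) (ε : ℝ), 0 < ε → ∃ K : ℝ, 0 < K ∧
      ∀ (W : WeierstrassCurve ℚ) [W.IsElliptic],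
        (∀ p : ℕ, p.Prime → p ∉ S → ¬ p ^ 2 ∣ W.conductorNorm ℤ) →
        ∀ D : Finset ℕ, D ⊆ (W.conductorNorm ℤ).primeFactors.filter
            (fun p => ¬ p ^ 2 ∣ W.conductorNorm ℤ) → Even D.card →
          ((∏ p ∈ D, (W.minimalDiscriminantNorm ℤ).factorization p : ℕ) : ℝ) <
            K * (W.conductorNorm ℤ : ℝ) ^ ((11 : ℝ) / 3 + ε)) :
    pasten_valuationProduct_awayFrom := by
  intro S ε hε
  obtain ⟨K, hK, hKW⟩ := h16 S (2 * ε / 3) (by positivity)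
  have hK₁1 : (1 : ℝ) ≤ max K 1 := le_max_right _ _
  have hK₁0 : (0 : ℝ) ≤ max K 1 := zero_le_one.trans hK₁1
  refine ⟨(max K 1) ^ 2, by positivity, fun W _ hS hcard ↦ ?_⟩
  have hN0 : W.conductorNorm ℤ ≠ 0 := by
    intro hN
    rw [hN, Nat.primeFactors_zero, Finset.filter_empty, Finset.card_empty] at hcard
    omega
  have hN1 : (1 : ℝ) ≤ (W.conductorNorm ℤ : ℝ) := by
    exact_mod_cast Nat.one_le_iff_ne_zero.mpr hN0
  have hN0' : (0 : ℝ) ≤ (W.conductorNorm ℤ : ℝ) := Nat.cast_nonneg _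
  set a : ℝ := (11 : ℝ) / 3 + 2 * ε / 3 with ha
  have ha0 : 0 ≤ a := by rw [ha]; positivity
  have hNa0 : (0 : ℝ) ≤ (W.conductorNorm ℤ : ℝ) ^ a := Real.rpow_nonneg hN0' a
  have hNa1 : (1 : ℝ) ≤ (W.conductorNorm ℤ : ℝ) ^ a := Real.one_le_rpow hN1 ha0
  have hB1 : (1 : ℝ) ≤ max K 1 * (W.conductorNorm ℤ : ℝ) ^ a :=
    one_le_mul_of_one_le_of_one_le hK₁1 hNa1
  have hmain := cast_prod_lt_rpow_of_forall_even
    (f := fun p => (W.minimalDiscriminantNorm ℤ).factorization p) hB1 hcard fun D hDT hDe ↦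
      (hKW W hS D hDT hDe).trans_le (mul_le_mul_of_nonneg_right (le_max_left K 1) hNa0)
  refine hmain.trans_le ?_
  rw [Real.mul_rpow hK₁0 hNa0, ← Real.rpow_mul hN0',
    show a * ((3 : ℝ) / 2) = (11 : ℝ) / 2 + ε by rw [ha]; ring]
  refine mul_le_mul_of_nonneg_right ?_ (Real.rpow_nonneg hN0' _)
  calc (max K 1) ^ ((3 : ℝ) / 2) ≤ (max K 1) ^ ((2 : ℕ) : ℝ) :=
        Real.rpow_le_rpow_of_exponent_le hK₁1 (by norm_num)
    _ = (max K 1) ^ 2 := Real.rpow_natCast _ 2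

/-- The same glue, read through the duplicate: Theorem 16.1 (constant form) also yields
`pastenShimura2024_cor_16_2` of `ValuationProductElliptic.lean`. [folklore] -/
theorem pastenShimura2024_cor_16_2_of_thm16_1
    (h16 : ∀ (S : Finset ℕ) (ε : ℝ), 0 < ε → ∃ K : ℝ, 0 < K ∧
      ∀ (W : WeierstrassCurve ℚ) [W.IsElliptic],
        (∀ p : ℕ, p.Prime → p ∉ S → ¬ p ^ 2 ∣ W.conductorNorm ℤ) →
        ∀ D : Finset ℕ, D ⊆ (W.conductorNorm ℤ).primeFactors.filter
            (fun p => ¬ p ^ 2 ∣ W.conductorNorm ℤ) → Even D.card →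
          ((∏ p ∈ D, (W.minimalDiscriminantNorm ℤ).factorization p : ℕ) : ℝ) <
            K * (W.conductorNorm ℤ : ℝ) ^ ((11 : ℝ) / 3 + ε)) :
    pastenShimura2024_cor_16_2 :=
  pasten_valuationProduct_awayFrom_iff_pastenShimura2024_cor_16_2.mp
    (pasten_valuationProduct_awayFrom_of_thm16_1 h16)

/-! ### Theorem 16.1 in threshold form ("for `N ≫_{ε,S} 1`", as its printed proof delivers it) -/

/-- **Corollary 16.2 from Theorem 16.1 in the form its printed proof proves it.** The proof of
Theorem 16.1 (arXiv:1705.09251, p. 49) ends with "(16.7) … for `N ≫_{ε,S} 1`" and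
"`log |c_f| ≪_S 1`, hence the result", i.e. it establishes: for every finite `S` and `ε > 0` there
is `N₀ = N₀(S, ε)` such that every `E/ℚ` semi-stable away from `S` with `N_E ≥ N₀` satisfies
`∏_{p ∣ D} v_p(Δ_E) < N_E^{11/3+ε}` for every admissible `N_E = DM` (the `O_S(1)` of the Manin
constant being absorbed by `ε` and `N₀`); "all but finitely many `E`" is this threshold read through
Shafarevich's theorem (p. 12). This theorem takes Theorem 16.1 in that threshold form — hypothesis
`h16`, over the vocabulary of `pasten_valuationProduct_awayFrom`: admissible `D` = a set of an even
number of primes `p ∥ N_E` — and proves `pasten_valuationProduct_awayFrom`: for `N_E ≥ N₀(S, 2ε/3)`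
the combinatorial core `cast_prod_lt_rpow_of_forall_even` gives
`∏_{p ∣ N_E^*} v_p(Δ_E) < (N_E^{11/3+2ε/3})^{3/2} = N_E^{11/2+ε}`, and the curves of conductor
`< N₀` fall into finitely many `ℚ`-isomorphism classes (Shafarevich, Silverman AEC IX.6.1 — the
tree's theorem `WeierstrassCurve.shafarevich_finite_goodReductionOutside_holds`), on which the
product is bounded by some `K₁`
(`Literature.NumberTheory.EllipticCurves.exists_multiplicativeValuationProduct_le_of_conductorNorm_lt`);
the constant is `K = K₁ + 1`. Theorem 16.1 itself (Shimura-curve parametrisations,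
Jacquet–Langlands and modularity, refined Ribet–Takahashi, Arakelov bounds) is only quoted as a
hypothesis, not vendored (D-0026).
[cite: PastenShimura2024, §16.1 Theorem ThmGeneralVal1 (arXiv Thm. 16.1) proof and Corollary CoroValGen (arXiv Cor. 16.2) proof; §2 p. 12] -/
theorem pasten_valuationProduct_awayFrom_of_thm16_1_threshold
    (h16 : ∀ (S : Finset ℕ) (ε : ℝ), 0 < ε → ∃ N₀ : ℕ,
      ∀ (W : WeierstrassCurve ℚ) [W.IsElliptic],
        (∀ p : ℕ, p.Prime → p ∉ S → ¬ p ^ 2 ∣ W.conductorNorm ℤ) →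
        N₀ ≤ W.conductorNorm ℤ →
        ∀ D : Finset ℕ, D ⊆ (W.conductorNorm ℤ).primeFactors.filter
            (fun p => ¬ p ^ 2 ∣ W.conductorNorm ℤ) → Even D.card →
          ((∏ p ∈ D, (W.minimalDiscriminantNorm ℤ).factorization p : ℕ) : ℝ) <
            (W.conductorNorm ℤ : ℝ) ^ ((11 : ℝ) / 3 + ε)) :
    pasten_valuationProduct_awayFrom := by
  intro S ε hε
  obtain ⟨N₀, hN₀⟩ := h16 S (2 * ε / 3) (by positivity)
  obtain ⟨K₁, hK₁, hsmall⟩ :=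
    EllipticCurves.exists_multiplicativeValuationProduct_le_of_conductorNorm_lt N₀
  refine ⟨K₁ + 1, by linarith, fun W _ hS hcard ↦ ?_⟩
  have hN0 : W.conductorNorm ℤ ≠ 0 := by
    intro hN
    rw [hN, Nat.primeFactors_zero, Finset.filter_empty, Finset.card_empty] at hcard
    omega
  have hN1 : (1 : ℝ) ≤ (W.conductorNorm ℤ : ℝ) := by
    exact_mod_cast Nat.one_le_iff_ne_zero.mpr hN0
  have hN0' : (0 : ℝ) ≤ (W.conductorNorm ℤ : ℝ) := Nat.cast_nonneg _
  have hrpow1 : (1 : ℝ) ≤ (W.conductorNorm ℤ : ℝ) ^ ((11 : ℝ) / 2 + ε) :=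
    Real.one_le_rpow hN1 (by positivity)
  by_cases hlt : W.conductorNorm ℤ < N₀
  · -- finitely many exceptional isomorphism classes (Shafarevich): the product is `≤ K₁`
    have h1 : (multiplicativeValuationProduct W : ℝ) ≤ K₁ := hsmall W hlt
    rw [multiplicativeValuationProduct_def] at h1
    calc _ ≤ K₁ := h1
      _ < K₁ + 1 := lt_add_one K₁
      _ ≤ (K₁ + 1) * (W.conductorNorm ℤ : ℝ) ^ ((11 : ℝ) / 2 + ε) :=
          le_mul_of_one_le_right (by linarith) hrpow1
  · -- `N_E ≥ N₀`: Theorem 16.1 for every admissible `D`, then the combinatorial core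
    set a : ℝ := (11 : ℝ) / 3 + 2 * ε / 3 with ha
    have ha0 : 0 ≤ a := by rw [ha]; positivity
    have hB1 : (1 : ℝ) ≤ (W.conductorNorm ℤ : ℝ) ^ a := Real.one_le_rpow hN1 ha0
    have hmain := cast_prod_lt_rpow_of_forall_even
      (f := fun p => (W.minimalDiscriminantNorm ℤ).factorization p) hB1 hcard
      fun D hDT hDe ↦ hN₀ W hS (not_lt.mp hlt) D hDT hDe
    rw [← Real.rpow_mul hN0', show a * ((3 : ℝ) / 2) = (11 : ℝ) / 2 + ε by rw [ha]; ring]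
      at hmain
    exact hmain.trans_le
      (le_mul_of_one_le_left (Real.rpow_nonneg hN0' _) (by linarith))

/-- Theorem 16.1 in threshold form also yields the duplicate `pastenShimura2024_cor_16_2` of
`ValuationProductElliptic.lean` (definitionally the same statement). [folklore] -/
theorem pastenShimura2024_cor_16_2_of_thm16_1_threshold
    (h16 : ∀ (S : Finset ℕ) (ε : ℝ), 0 < ε → ∃ N₀ : ℕ,
      ∀ (W : WeierstrassCurve ℚ) [W.IsElliptic],
        (∀ p : ℕ, p.Prime → p ∉ S → ¬ p ^ 2 ∣ W.conductorNorm ℤ) →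
        N₀ ≤ W.conductorNorm ℤ →
        ∀ D : Finset ℕ, D ⊆ (W.conductorNorm ℤ).primeFactors.filter
            (fun p => ¬ p ^ 2 ∣ W.conductorNorm ℤ) → Even D.card →
          ((∏ p ∈ D, (W.minimalDiscriminantNorm ℤ).factorization p : ℕ) : ℝ) <
            (W.conductorNorm ℤ : ℝ) ^ ((11 : ℝ) / 3 + ε)) :
    pastenShimura2024_cor_16_2 :=
  pasten_valuationProduct_awayFrom_iff_pastenShimura2024_cor_16_2.mp
    (pasten_valuationProduct_awayFrom_of_thm16_1_threshold h16)

/-- … and the geometric rendering `Literature.NumberTheory.EllipticCurves.pasten_cor_16_2` of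
`EllipticCurves/PastenValuationProduct.lean` (places of `ℤ`, `finprod` of `ord_v Δ_min`, threshold
`N_E ≥ N₀`), through the tree's
`Literature.NumberTheory.EllipticCurves.pasten_cor_16_2_iff_pasten_valuationProduct_awayFrom`.
[folklore] -/
theorem pasten_cor_16_2_of_thm16_1_threshold
    (h16 : ∀ (S : Finset ℕ) (ε : ℝ), 0 < ε → ∃ N₀ : ℕ,
      ∀ (W : WeierstrassCurve ℚ) [W.IsElliptic],
        (∀ p : ℕ, p.Prime → p ∉ S → ¬ p ^ 2 ∣ W.conductorNorm ℤ) →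
        N₀ ≤ W.conductorNorm ℤ →
        ∀ D : Finset ℕ, D ⊆ (W.conductorNorm ℤ).primeFactors.filter
            (fun p => ¬ p ^ 2 ∣ W.conductorNorm ℤ) → Even D.card →
          ((∏ p ∈ D, (W.minimalDiscriminantNorm ℤ).factorization p : ℕ) : ℝ) <
            (W.conductorNorm ℤ : ℝ) ^ ((11 : ℝ) / 3 + ε)) :
    EllipticCurves.pasten_cor_16_2 :=
  EllipticCurves.pasten_cor_16_2_iff_pasten_valuationProduct_awayFrom.mpr
    (pasten_valuationProduct_awayFrom_of_thm16_1_threshold h16)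

/-! ### The real-arithmetic skeleton of the printed proof of Theorem 16.1 -/

section Thm16_1Skeleton

/-- Absorbing `log log N`: for `a > 0`, `B ≥ 0` and `y ≥ (2B/a)²` one has `B · log y ≤ a · y`
(`log y ≤ 2√y`). [folklore] -/
theorem pasten_thm16_1.mul_log_le_mul_of_sq_le {a B y : ℝ} (ha : 0 < a) (hB : 0 ≤ B)
    (hy : (2 * B / a) ^ 2 ≤ y) : B * Real.log y ≤ a * y := by
  have hy0 : 0 ≤ y := le_trans (sq_nonneg _) hy
  have hs : 2 * B / a ≤ Real.sqrt y := by
    rw [show 2 * B / a = Real.sqrt ((2 * B / a) ^ 2) by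
      rw [Real.sqrt_sq (by positivity)]]
    exact Real.sqrt_le_sqrt hy
  have hs0 : 0 ≤ Real.sqrt y := Real.sqrt_nonneg y
  have hlog : Real.log y ≤ 2 * Real.sqrt y := by
    -- `log y ≤ y^{1/2} / (1/2)` (Mathlib's `Real.log_le_rpow_div`)
    have h := Real.log_le_rpow_div hy0 (by norm_num : (0 : ℝ) < 1 / 2)
    rw [← Real.sqrt_eq_rpow] at h
    linarith
  calc B * Real.log y ≤ B * (2 * Real.sqrt y) := mul_le_mul_of_nonneg_left hlog hB
    _ = (2 * B / a) * Real.sqrt y * a := by field_simp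
    _ ≤ Real.sqrt y * Real.sqrt y * a := by gcongr
    _ = a * y := by rw [Real.mul_self_sqrt hy0]; ring

/-- **The pointwise bookkeeping of the proof of Theorem 16.1** (arXiv:1705.09251, p. 49, from
(EqUsingRT) to (16.7)), over bare reals. For one curve `E` (conductor `N`, `L = log N > 0`) and one
admissible `N = DM` with `D > 1` (`d = D`, `ω = ω(D)`), write `P = ∏_{p ∣ D} v_p(Δ_E)`,
`δ₁ = δ_{1,N}`, `δ = δ_{D,M}`, `φ = deg φ_{D,M}`, `F = ‖f‖`, `F' = ‖f_{D,M}‖`, `c = c_f > 0` (Manin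
constant), `h₁ = h(A_{1,N})`, `h' = h(A_{D,M})`. If
(RT) `log P ≤ log δ₁ − log δ + log d + C_RT ω` (Thm. 6.1 (a)),
(Frey) `log δ₁ = 2 log(2π c) + 2 log F + 2 h₁`,
(deg) `δ ≤ φ ≤ (9L)² δ` (Cor. CoroDegApproxQ), (Frey') `log φ = 2 log F' + 2 h'`,
(isog) `2|h₁ − h'| ≤ log 163` (Mazur–Kenku, Faltings), (Murty) `F² ≤ C_Mu N L`,
(14.1) `−2 log F' ≤ (5/3 + ε/2) L + log(N/d)`, (Manin) `log c ≤ C_Ma`,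
then `log P ≤ (11/3 + ε/2) L + (2 log 2π + 2 C_Ma + log C_Mu + log 163 + 2 log 9) + 3 log L + C_RT ω`.
[cite: PastenShimura2024, §16.1 proof of Theorem ThmGeneralVal1 (arXiv Thm. 16.1), p. 49] -/
theorem pasten_thm16_1.pointwise {ε N d L P δ₁ δ φ F F' c h₁ h' C_RT C_Mu C_Ma ω : ℝ}
    (hN : 0 < N) (hd : 0 < d) (hL : 0 < L) (hLN : Real.log N = L)
    (hδ : 0 < δ) (hF : 0 < F) (hc : 0 < c) (hCMu : 0 < C_Mu)
    (hRT : Real.log P ≤ Real.log δ₁ - Real.log δ + Real.log d + C_RT * ω)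
    (hFrey : Real.log δ₁ = 2 * Real.log (2 * Real.pi * c) + 2 * Real.log F + 2 * h₁)
    (hdeg₁ : δ ≤ φ) (hdeg₂ : φ ≤ (9 * L) ^ 2 * δ)
    (hFrey' : Real.log φ = 2 * Real.log F' + 2 * h')
    (hisog : 2 * |h₁ - h'| ≤ Real.log 163)
    (hMu : F ^ 2 ≤ C_Mu * N * L)
    (h141 : -2 * Real.log F' ≤ (5 / 3 + ε / 2) * L + Real.log (N / d))
    (hMa : Real.log c ≤ C_Ma) :
    Real.log P ≤ (11 / 3 + ε / 2) * L +
      (2 * Real.log (2 * Real.pi) + 2 * C_Ma + Real.log C_Mu + Real.log 163 + 2 * Real.log 9) +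
      3 * Real.log L + C_RT * ω := by
  have hφ : 0 < φ := hδ.trans_le hdeg₁
  -- `-log δ ≤ -log φ + 2 log (9 L)`
  have h9L : 0 < 9 * L := by positivity
  have hlogδ : -Real.log δ ≤ -Real.log φ + 2 * Real.log (9 * L) := by
    have h1 : Real.log φ ≤ Real.log ((9 * L) ^ 2 * δ) := Real.log_le_log hφ hdeg₂
    rw [Real.log_mul (by positivity) hδ.ne', Real.log_pow] at h1
    push_cast at h1
    linarith
  have hlog9L : Real.log (9 * L) = Real.log 9 + Real.log L :=
    Real.log_mul (by norm_num) hL.ne'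
  -- `2 log F ≤ log C_Mu + log N + log L`
  have hlogF : 2 * Real.log F ≤ Real.log C_Mu + L + Real.log L := by
    have h1 : Real.log (F ^ 2) ≤ Real.log (C_Mu * N * L) := Real.log_le_log (by positivity) hMu
    rw [Real.log_pow, Real.log_mul (by positivity) hL.ne', Real.log_mul hCMu.ne' hN.ne', hLN] at h1
    push_cast at h1
    linarith
  -- `2 log (2π c) = 2 log 2π + 2 log c ≤ 2 log 2π + 2 C_Ma`
  have hlog2πc : Real.log (2 * Real.pi * c) = Real.log (2 * Real.pi) + Real.log c :=
    Real.log_mul (by positivity) hc.ne'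
  -- `log (N/d) + log d = L`
  have hlogNd : Real.log (N / d) + Real.log d = L := by
    rw [Real.log_div hN.ne' hd.ne', hLN]; ring
  -- `2 h₁ - 2 h' ≤ log 163`
  have hh : 2 * h₁ - 2 * h' ≤ Real.log 163 := by
    have := le_abs_self (h₁ - h'); linarith
  linarith [hRT, hFrey, hFrey', hlogδ, hlogF, h141, hMa, hh, hlog9L, hlog2πc, hlogNd]

/-- `ω(N) log 2 ≤ log C_δ + δ log N`: the number of prime factors is `o(log N)` (from the tree's
`exists_two_pow_card_primeFactors_le`: `2^{ω(n)} ≤ C_δ rad(n)^δ`, and `rad(n) ≤ n`). [folklore] -/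
theorem pasten_thm16_1.exists_card_primeFactors_mul_log_two_le {δ : ℝ} (hδ : 0 < δ) :
    ∃ C : ℝ, 0 < C ∧ ∀ n : ℕ, n ≠ 0 →
      (n.primeFactors.card : ℝ) * Real.log 2 ≤ Real.log C + δ * Real.log n := by
  obtain ⟨C, hC0, hC⟩ := exists_two_pow_card_primeFactors_le δ hδ
  refine ⟨C, hC0, fun n hn ↦ ?_⟩
  have hn0 : (0 : ℝ) < n := by exact_mod_cast Nat.pos_of_ne_zero hn
  have hrad : (∏ p ∈ n.primeFactors, (p : ℝ)) ≤ n := by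
    have h1 : (∏ p ∈ n.primeFactors, p : ℕ) ≤ n := Nat.le_of_dvd (Nat.pos_of_ne_zero hn)
      (Nat.prod_primeFactors_dvd n)
    rw [← Nat.cast_prod]
    exact_mod_cast h1
  have hrad0 : (0 : ℝ) ≤ ∏ p ∈ n.primeFactors, (p : ℝ) :=
    Finset.prod_nonneg fun _ _ ↦ Nat.cast_nonneg _
  have h2 : (2 : ℝ) ^ n.primeFactors.card ≤ C * (n : ℝ) ^ δ :=
    (hC n).trans (mul_le_mul_of_nonneg_left (Real.rpow_le_rpow hrad0 hrad hδ.le) hC0.le)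
  have h3 : Real.log ((2 : ℝ) ^ n.primeFactors.card) ≤ Real.log (C * (n : ℝ) ^ δ) :=
    Real.log_le_log (by positivity) h2
  rwa [Real.log_pow, Real.log_mul hC0.ne' (Real.rpow_pos_of_pos hn0 δ).ne', Real.log_rpow hn0]
    at h3

/-- **Theorem 16.1 (threshold form) from the inputs of its printed proof.** Pasten's proof of
Theorem 16.1 (arXiv:1705.09251, p. 49) is, for each `E/ℚ` semi-stable away from `S` of conductor
`N` and each admissible `N = DM` with `D > 1`, the chain
(EqUsingRT) `log ∏_{p ∣ D} v_p(Δ_E) ≤ log δ_{1,N} − log δ_{D,M} + log D + O_S(ω(D))` [Thm. 6.1 (a),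
refined Ribet–Takahashi], (EqFreyClassical) `log δ_{1,N} = 2 log(2π c_f) + 2 log ‖f‖ + 2 h(A_{1,N})`
[Frey's formula], (Eqdnfje) `δ_{D,M} ≤ deg φ_{D,M} ≤ (9 log N)² δ_{D,M}` [Cor. CoroDegApproxQ],
(EqFreyQuaternionic) `log deg φ_{D,M} = 2 log ‖f_{D,M}‖ + 2 h(A_{D,M})`,
`2|h(A_{1,N}) − h(A_{D,M})| ≤ log 163` [Mazur–Kenku isogeny bound, Faltings],
`‖f‖² ≪ N log N` [Mai–Murty, Murty], `−2 log ‖f_{D,M}‖ ≤ (5/3 + ε/2) log N + log M` for `N ≫_ε 1`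
[Thm. 14.1, integral quaternionic forms are not too small] and `log c_f ≪_S 1` [Cor. CoroManinCt],
"hence the result" for `N ≫_{ε,S} 1`. None of these eight inputs exists in the tree (no Shimura
curves `X_0^D(M)`, optimal quotients `A_{D,M}`, `δ_{D,M}`, `f_{D,M}`, Faltings heights of the
`A_{D,M}`); this theorem takes them, for the curves of conductor `≥ N₁` and their admissible
`D > 1` (a nonempty set of an even number of primes `p ∥ N_E`, `D = ∏ D`, `M = N/D`), as ONE
hypothesis `H` supplying the eight real quantities `δ₁ = δ_{1,N}`, `δ = δ_{D,M}`, `φ = deg φ_{D,M}`,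
`F = ‖f‖`, `F' = ‖f_{D,M}‖`, `c = c_f > 0`, `h₁ = h(A_{1,N})`, `h' = h(A_{D,M})` with the displayed
relations (constants `C_RT = O_S(1)` of Thm. 6.1 (a), `C_Mu` of Murty's bound, `C_Ma = O_S(1)` of the
Manin constant, threshold `N₁ = N₁(ε)` of Thm. 14.1 at `ε/4`), and performs the printed deduction:
the pointwise bookkeeping `pasten_thm16_1.pointwise` gives
`log ∏ ≤ (11/3 + ε/2) log N + O_S(1) + 3 log log N + C_RT ω(D)`, and for `N ≫_{ε,S} 1` the last
three terms are `< (ε/2) log N` (`ω(D) ≤ ω(N) = o(log N)`, `pasten_thm16_1.exists_card_primeFactors_mul_log_two_le`;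
`3 log log N ≤ (ε/6) log N` once `log N ≥ (36/ε)²`, `pasten_thm16_1.mul_log_le_mul_of_sq_le`). For `D = ∅`
(`D = 1`) the product is `1 < N^{11/3+ε}`. The conclusion is Theorem 16.1 in the threshold form
consumed by `pasten_valuationProduct_awayFrom_of_thm16_1_threshold`.
[cite: PastenShimura2024, §16.1 Theorem ThmGeneralVal1 (arXiv Thm. 16.1), proof, p. 49] -/
theorem pasten_thm16_1_threshold_of_printedInputs (S : Finset ℕ) {ε : ℝ} (hε : 0 < ε)
    {C_RT C_Mu C_Ma : ℝ} (hCMu : 0 < C_Mu) {N₁ : ℕ}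
    (H : ∀ (W : WeierstrassCurve ℚ) [W.IsElliptic],
      (∀ p : ℕ, p.Prime → p ∉ S → ¬ p ^ 2 ∣ W.conductorNorm ℤ) → N₁ ≤ W.conductorNorm ℤ →
      ∀ D : Finset ℕ, D ⊆ (W.conductorNorm ℤ).primeFactors.filter
          (fun p => ¬ p ^ 2 ∣ W.conductorNorm ℤ) → Even D.card → D.Nonempty →
        ∃ δ₁ δ φ F F' c h₁ h' : ℝ, 0 < δ ∧ 0 < F ∧ 0 < c ∧
          Real.log ((∏ p ∈ D, (W.minimalDiscriminantNorm ℤ).factorization p : ℕ) : ℝ) ≤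
              Real.log δ₁ - Real.log δ + Real.log ((∏ p ∈ D, p : ℕ) : ℝ) + C_RT * D.card ∧
          Real.log δ₁ = 2 * Real.log (2 * Real.pi * c) + 2 * Real.log F + 2 * h₁ ∧
          δ ≤ φ ∧ φ ≤ (9 * Real.log (W.conductorNorm ℤ : ℝ)) ^ 2 * δ ∧
          Real.log φ = 2 * Real.log F' + 2 * h' ∧
          2 * |h₁ - h'| ≤ Real.log 163 ∧
          F ^ 2 ≤ C_Mu * (W.conductorNorm ℤ : ℝ) * Real.log (W.conductorNorm ℤ : ℝ) ∧
          -2 * Real.log F' ≤ (5 / 3 + ε / 2) * Real.log (W.conductorNorm ℤ : ℝ) +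
              Real.log ((W.conductorNorm ℤ : ℝ) / ((∏ p ∈ D, p : ℕ) : ℝ)) ∧
          Real.log c ≤ C_Ma) :
    ∃ N₀ : ℕ, ∀ (W : WeierstrassCurve ℚ) [W.IsElliptic],
      (∀ p : ℕ, p.Prime → p ∉ S → ¬ p ^ 2 ∣ W.conductorNorm ℤ) → N₀ ≤ W.conductorNorm ℤ →
      ∀ D : Finset ℕ, D ⊆ (W.conductorNorm ℤ).primeFactors.filter
          (fun p => ¬ p ^ 2 ∣ W.conductorNorm ℤ) → Even D.card →
        ((∏ p ∈ D, (W.minimalDiscriminantNorm ℤ).factorization p : ℕ) : ℝ) <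
          (W.conductorNorm ℤ : ℝ) ^ ((11 : ℝ) / 3 + ε) := by
  -- the `O_S(ω(D))` term: `ω(D) ≤ ω(N) = o(log N)`
  set R : ℝ := max C_RT 0 + 1 with hR
  have hR0 : 0 < R := by rw [hR]; positivity
  have hlog2 : 0 < Real.log 2 := Real.log_pos one_lt_two
  obtain ⟨C, hC0, hC⟩ := pasten_thm16_1.exists_card_primeFactors_mul_log_two_le
    (δ := ε * Real.log 2 / (6 * R)) (by positivity)
  -- the constant of the proof
  set A : ℝ := 2 * Real.log (2 * Real.pi) + 2 * C_Ma + Real.log C_Mu + Real.log 163 +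
    2 * Real.log 9 + R * Real.log C / Real.log 2 with hA
  refine ⟨max (max N₁ 3) (max ⌈Real.exp ((2 * 3 / (ε / 6)) ^ 2)⌉₊ (⌈Real.exp (6 * A / ε)⌉₊ + 1)),
    fun W _ hS hN₀ D hDT hDe ↦ ?_⟩
  simp only [max_le_iff] at hN₀
  obtain ⟨⟨hN₁, hN3⟩, hNexp₁, hNexp₂⟩ := hN₀
  set N : ℕ := W.conductorNorm ℤ with hNdef
  have hN0 : N ≠ 0 := by omega
  have hNpos : (0 : ℝ) < N := by exact_mod_cast Nat.pos_of_ne_zero hN0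
  have hN1 : (1 : ℝ) < N := by exact_mod_cast (show 1 < N by omega)
  set L : ℝ := Real.log N with hLdef
  have hL1 : 1 < L := by
    rw [hLdef, ← Real.exp_lt_exp, Real.exp_log hNpos]
    have h3 : (3 : ℝ) ≤ N := by exact_mod_cast hN3
    have he : Real.exp 1 < 3 := lt_trans Real.exp_one_lt_d9 (by norm_num)
    exact he.trans_le h3
  have hL0 : 0 < L := one_pos.trans hL1
  -- thresholds in terms of `L`
  have hLexp₁ : (2 * 3 / (ε / 6)) ^ 2 ≤ L := by
    have h1 : Real.exp ((2 * 3 / (ε / 6)) ^ 2) ≤ N := (Nat.le_ceil _).trans (by exact_mod_cast hNexp₁)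
    rw [hLdef, ← Real.log_exp ((2 * 3 / (ε / 6)) ^ 2)]
    exact Real.log_le_log (Real.exp_pos _) h1
  have hLexp₂ : 6 * A / ε < L := by
    have h1 : Real.exp (6 * A / ε) < N := by
      have h2 : (⌈Real.exp (6 * A / ε)⌉₊ : ℝ) + 1 ≤ N := by exact_mod_cast hNexp₂
      linarith [Nat.le_ceil (Real.exp (6 * A / ε))]
    rw [hLdef, ← Real.log_exp (6 * A / ε)]
    exact Real.log_lt_log (Real.exp_pos _) h1
  have hA_lt : A < ε / 6 * L := by
    rw [div_lt_iff₀ hε] at hLexp₂; linarith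
  have hloglog : 3 * Real.log L ≤ ε / 6 * L :=
    pasten_thm16_1.mul_log_le_mul_of_sq_le (by positivity) (by norm_num) hLexp₁
  -- the target exponent is positive, so the empty product (`D = 1`) is fine
  have hexp0 : 0 < (11 : ℝ) / 3 + ε := by positivity
  rcases D.eq_empty_or_nonempty with rfl | hDne
  · rw [Finset.prod_empty, Nat.cast_one]
    exact Real.one_lt_rpow hN1 hexp0
  -- `ω`-absorption: `C_RT · #D ≤ R log C / log 2 + (ε/6) L`
  have hcardD : (D.card : ℝ) ≤ N.primeFactors.card := by
    exact_mod_cast Finset.card_le_card (hDT.trans (Finset.filter_subset _ _))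
  have hω : C_RT * D.card ≤ R * Real.log C / Real.log 2 + ε / 6 * L := by
    have h1 : C_RT * D.card ≤ R * N.primeFactors.card := by
      have h2 : C_RT ≤ R := by rw [hR]; linarith [le_max_left C_RT 0]
      have h3 : (0 : ℝ) ≤ D.card := Nat.cast_nonneg _
      calc C_RT * D.card ≤ R * D.card := mul_le_mul_of_nonneg_right h2 h3
        _ ≤ R * N.primeFactors.card := mul_le_mul_of_nonneg_left hcardD hR0.le
    have h4 := hC N hN0
    -- `ω(N) ≤ log C / log 2 + (ε / 6R) L`
    have h4' : (N.primeFactors.card : ℝ) ≤ Real.log C / Real.log 2 + ε / (6 * R) * L := by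
      rw [div_add' _ _ _ hlog2.ne', le_div_iff₀ hlog2]
      calc (N.primeFactors.card : ℝ) * Real.log 2
            ≤ Real.log C + ε * Real.log 2 / (6 * R) * Real.log N := h4
        _ = Real.log C + ε / (6 * R) * L * Real.log 2 := by rw [hLdef]; ring
    have h6 : R * (ε / (6 * R)) = ε / 6 := by field_simp
    have h7 : R * (N.primeFactors.card : ℝ) ≤ R * Real.log C / Real.log 2 + ε / 6 * L := by
      calc R * (N.primeFactors.card : ℝ)
            ≤ R * (Real.log C / Real.log 2 + ε / (6 * R) * L) := mul_le_mul_of_nonneg_left h4' hR0.le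
        _ = R * Real.log C / Real.log 2 + R * (ε / (6 * R)) * L := by ring
        _ = R * Real.log C / Real.log 2 + ε / 6 * L := by rw [h6]
    exact h1.trans h7
  -- the eight inputs for `(W, D)`
  obtain ⟨δ₁, δ, φ, F, F', c, h₁, h', hδ, hF, hc, hRT, hFrey, hdeg₁, hdeg₂, hFrey', hisog, hMu,
    h141, hMa⟩ := H W hS hN₁ D hDT hDe hDne
  have hd : (0 : ℝ) < ((∏ p ∈ D, p : ℕ) : ℝ) := by
    have : 0 < ∏ p ∈ D, p := Finset.prod_pos fun p hp ↦
      (Nat.prime_of_mem_primeFactors (Finset.mem_filter.mp (hDT hp)).1).pos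
    exact_mod_cast this
  set P : ℝ := ((∏ p ∈ D, (W.minimalDiscriminantNorm ℤ).factorization p : ℕ) : ℝ) with hP
  have hpt := pasten_thm16_1.pointwise (ε := ε) hNpos hd hL0 hLdef.symm hδ hF hc hCMu hRT hFrey hdeg₁
    hdeg₂ hFrey' hisog hMu h141 hMa
  -- assemble: `log P < (11/3 + ε) L`
  have hlogP : Real.log P < ((11 : ℝ) / 3 + ε) * L := by
    have hsplit : 2 * Real.log (2 * Real.pi) + 2 * C_Ma + Real.log C_Mu + Real.log 163 +
        2 * Real.log 9 + (R * Real.log C / Real.log 2) = A := by rw [hA]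
    linarith [hpt, hω, hloglog, hA_lt, hsplit]
  have hP0 : 0 ≤ P := Nat.cast_nonneg _
  rcases hP0.eq_or_lt with hP00 | hPpos
  · rw [← hP00]; exact Real.rpow_pos_of_pos hNpos _
  · rw [← Real.log_lt_log_iff hPpos (Real.rpow_pos_of_pos hNpos _), Real.log_rpow hNpos]
    exact hlogP

/-- **Corollary 16.2 (`pasten_valuationProduct_awayFrom`) from the eight inputs of the printed
proof of Theorem 16.1**, for every `S` and `ε`: `pasten_thm16_1_threshold_of_printedInputs`
(Theorem 16.1 in threshold form) followed by `pasten_valuationProduct_awayFrom_of_thm16_1_threshold`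
(Pasten's proof of Cor. 16.2 plus Shafarevich). This is the whole of p. 49 of arXiv:1705.09251;
what it leaves open are exactly the deep inputs listed in `H` (refined Ribet–Takahashi Thm. 6.1 (a),
Frey's formula for `X_0(N) → A_{1,N}` and for `X_0^D(M) → A_{D,M}`, Cor. CoroDegApproxQ, the
Mazur–Kenku isogeny bound with Faltings' Lemma 5, Murty's bound `‖f‖² ≪ N log N`, Thm. 14.1 and
Cor. CoroManinCt), none of which is stated in the tree yet (no Shimura curves `X_0^D(M)`).
[cite: PastenShimura2024, §16.1 Theorem ThmGeneralVal1 and Corollary CoroValGen (arXiv Thm. 16.1, Cor. 16.2), p. 49] -/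
theorem pasten_valuationProduct_awayFrom_of_printedInputs
    (H : ∀ (S : Finset ℕ) (ε : ℝ), 0 < ε → ∃ (C_RT C_Mu C_Ma : ℝ) (N₁ : ℕ), 0 < C_Mu ∧
      ∀ (W : WeierstrassCurve ℚ) [W.IsElliptic],
        (∀ p : ℕ, p.Prime → p ∉ S → ¬ p ^ 2 ∣ W.conductorNorm ℤ) → N₁ ≤ W.conductorNorm ℤ →
        ∀ D : Finset ℕ, D ⊆ (W.conductorNorm ℤ).primeFactors.filter
            (fun p => ¬ p ^ 2 ∣ W.conductorNorm ℤ) → Even D.card → D.Nonempty →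
          ∃ δ₁ δ φ F F' c h₁ h' : ℝ, 0 < δ ∧ 0 < F ∧ 0 < c ∧
            Real.log ((∏ p ∈ D, (W.minimalDiscriminantNorm ℤ).factorization p : ℕ) : ℝ) ≤
                Real.log δ₁ - Real.log δ + Real.log ((∏ p ∈ D, p : ℕ) : ℝ) + C_RT * D.card ∧
            Real.log δ₁ = 2 * Real.log (2 * Real.pi * c) + 2 * Real.log F + 2 * h₁ ∧
            δ ≤ φ ∧ φ ≤ (9 * Real.log (W.conductorNorm ℤ : ℝ)) ^ 2 * δ ∧
            Real.log φ = 2 * Real.log F' + 2 * h' ∧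
            2 * |h₁ - h'| ≤ Real.log 163 ∧
            F ^ 2 ≤ C_Mu * (W.conductorNorm ℤ : ℝ) * Real.log (W.conductorNorm ℤ : ℝ) ∧
            -2 * Real.log F' ≤ (5 / 3 + ε / 2) * Real.log (W.conductorNorm ℤ : ℝ) +
                Real.log ((W.conductorNorm ℤ : ℝ) / ((∏ p ∈ D, p : ℕ) : ℝ)) ∧
            Real.log c ≤ C_Ma) :
    pasten_valuationProduct_awayFrom :=
  pasten_valuationProduct_awayFrom_of_thm16_1_threshold fun S ε hε ↦ by
    obtain ⟨C_RT, C_Mu, C_Ma, N₁, hCMu, H'⟩ := H S ε hε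
    exact pasten_thm16_1_threshold_of_printedInputs S hε hCMu H'

end Thm16_1Skeleton

end Literature.NumberTheory.DiophantineGeometry

end
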